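import Summits.BirchSwinnertonDyer.Rank1Residual.Supersingular.BlindPointSharpTwo
import HarnessLib

/-!
# The DERIVATIVE of the Mazur–Tate functional equation at the blind point `T = −2` (`p = 2`)
# (cell `b2b-bsdres`, O1 sub-cell `p = 2`; cc-typer-4 GEN 7, typer item (27″) "9b as a theorem",
# part 1/2)

HONEST FRAMING (run/shared/lean/b2b/bsd-rank1-residual/, verbatim in every file): the goal of the
cell is to DELETE the COMBINATION-SHAPED residual classes of the Birch–Swinnerton-Dyer formula for
ALL analytic-rank `≤ 1` elliptic curves over `ℚ` — "full BSD formula for every rank `≤ 1` curve in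
class `C`" assembled STRICTLY from published theorems — so that the rank-`≤ 1` remainder becomes
exactly the CONSTRUCTION-SHAPED classes, which are TYPED (missing-input `Prop`s), NOT attempted.
This is not "finishing BSD". THEOREMS ONLY about the tree's typed objects (`mazurTateElement`,
`IsFrickeEigen`, `ratPlusSymbol`); every hypothesis explicit; nothing about any particular curve is
asserted; nothing booked; no label moves.

WHAT. At `p = 2` the involution `1 + T ↦ (1+T)⁻¹` has the second fixed point `T = −2` (Greenberg,
LNM 1716, p. 181; the tree's `BlindPointSharpTwo.lean`). The functional equation of the Mazur–Tate
element `θ_n(f,T) = Σ_{a} [a/2^{n+2}]⁺_f (1+T)^{s(a)}` in its EXACT reflected-sum form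
(`mazurTateElement_eq_mul_reflect`: `θ_n = σ · Σ_a [a/2^{n+2}]⁺ (1+T)^{(−s_N − s(a)) mod 2ⁿ}`,
Ota 2018 Prop. 5.16 / Mazur–Tate–Teitelbaum §I.17) is DIFFERENTIATED at `T = −2`. Writing
`s′(a) := (−s_N − s(a)) mod 2ⁿ ∈ [0, 2ⁿ)` and `κ := (−s_N) mod 2ⁿ`, one has EXACTLY
`s(a) + s′(a) = κ + 2ⁿ·m(a)` with an INTEGER `m(a) ∈ {0, 1}` (the carry), hence
`(−1)^{s′(a)} = (−1)^κ (−1)^{s(a)}` (`n ≥ 1`) and the values / derivatives of `(1+T)^{s′(a)}` at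
`−2` are `(−1)^κ(−1)^{s(a)}` and `−(κ + 2ⁿm(a) − s(a))(−1)^κ(−1)^{s(a)}`. Summing:

* `(1 − w)·θ_n(−2) = 0` and **`(1 + w)·θ_n′(−2) + w·κ·θ_n(−2) = −w·2ⁿ·E_n`**, `w := σ(−1)^κ = σ·χ₈(N)`,
  with the CARRY SUM `E_n := Σ_a m(a)·[a/2^{n+2}]⁺_f·(−1)^{s(a)}` (§2,
  `mazurTateElement_derivative_eval_neg_two`); at `w = +1` (`w(E ⊗ χ₈) = +1` for `f = f_E`):
  **`2·θ_n′(−2) + κ·θ_n(−2) = −2ⁿ·E_n`** (`two_mul_derivative_mazurTateElement_eval_neg_two`);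
* `‖E_n‖₂ ≤ 2` when the symbols are `2`-adically bounded by `2` (§3; for `2 ∤ N`, `a₂` even this is
  the tree's `norm_ratPlusSymbol_div_two_pow_le_two_of_even`), so the right-hand side is
  `O(2^{n−1})` — the input "(FE)" of the blind `♭`-law (`BlindPointFlatTwo.lean`).

The congruence form `θ_n ≡ σ(1+T)^c θ_n(ι) (mod ω_n)` would NOT do here: a congruence modulo `ω_n`
is blind to derivatives at the simple root `−2`; the exact reflected sum keeps the carry `2ⁿ m(a)`.

References: B. Mazur, J. Tate, J. Teitelbaum, Invent. Math. 84 (1986) §I.17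
[MazurTateTeitelbaum1986Invent]; K. Ota, Amer. J. Math. 140 (2018) Prop. 5.16 [Ota2018];
R. Greenberg, LNM 1716 (1999) p. 181 [GreenbergLNM1716]. Folder record:
`HOME/class-closure/O1/TYPING.md` §10.
-/

set_option autoImplicit false

noncomputable section

open scoped Classical MatrixGroups ModularForm

open Polynomial CongruenceSubgroup Literature.NumberTheory.EllipticCurves
  Literature.NumberTheory.EllipticCurves.ModularForms

namespace Summit.BirchSwinnertonDyer.Rank1Residual.Supersingular

namespace BlindFlat

variable {N : ℕ} [NeZero N] {f : CuspForm (Gamma0 N) 2}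

/-! ## §1. Values and derivatives of `(1+T)^j` at `T = −2` -/

omit [NeZero N] in
/-- `((1+T)^j)(−2) = (−1)^j`. [folklore] -/
theorem eval_neg_two_X_add_one_pow (j : ℕ) : ((X + 1 : ℚ[X]) ^ j).eval (-2) = (-1) ^ j := by
  rw [eval_pow, eval_add, eval_X, eval_one]
  norm_num

omit [NeZero N] in
/-- `((1+T)^j)′(−2) = j(−1)^{j−1} = −j(−1)^j`. [folklore] -/
theorem eval_neg_two_derivative_X_add_one_pow (j : ℕ) :
    (derivative ((X + 1 : ℚ[X]) ^ j)).eval (-2) = -((j : ℚ) * (-1) ^ j) := by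
  rw [← C_1, derivative_X_add_C_pow, eval_mul, eval_C, eval_pow, eval_add, eval_X, eval_C,
    show (-2 : ℚ) + 1 = -1 by norm_num]
  cases j with
  | zero => simp
  | succ k => rw [Nat.add_sub_cancel, pow_succ]; ring

omit [NeZero N] in
/-- Value at `−2` of a finite sum `Σ_i C(w_i)(1+T)^{j_i}`. [folklore] -/
theorem eval_neg_two_sum_C_mul_pow {ι : Type*} (s : Finset ι) (w : ι → ℚ) (j : ι → ℕ) :
    (∑ i ∈ s, C (w i) * (X + 1 : ℚ[X]) ^ j i).eval (-2) = ∑ i ∈ s, w i * (-1) ^ j i := by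
  rw [eval_finsetSum]
  refine Finset.sum_congr rfl fun i _ ↦ ?_
  rw [eval_mul, eval_C, eval_neg_two_X_add_one_pow]

omit [NeZero N] in
/-- Derivative at `−2` of a finite sum `Σ_i C(w_i)(1+T)^{j_i}`. [folklore] -/
theorem eval_neg_two_derivative_sum_C_mul_pow {ι : Type*} (s : Finset ι) (w : ι → ℚ) (j : ι → ℕ) :
    (derivative (∑ i ∈ s, C (w i) * (X + 1 : ℚ[X]) ^ j i)).eval (-2) =
      -∑ i ∈ s, (j i : ℚ) * (w i * (-1) ^ j i) := by
  rw [derivative_sum, eval_finsetSum, ← Finset.sum_neg_distrib]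
  refine Finset.sum_congr rfl fun i _ ↦ ?_
  rw [derivative_C_mul, eval_mul, eval_C, eval_neg_two_derivative_X_add_one_pow]
  ring

/-! ## §2. The functional equation at `−2`, differentiated -/

omit [NeZero N] in
/-- **The carry.** For `s, s_N ∈ ℤ/2ⁿ`: `s.val + (−s_N − s).val = (−s_N).val + 2ⁿ·m` with
`m = (s.val + (−s_N − s).val) / 2ⁿ ∈ ℕ` (the two residues in `[0, 2ⁿ)` add up to `κ` or `κ + 2ⁿ`).
[folklore] -/
theorem val_add_val_neg_sub_eq (n : ℕ) (sN s : ZMod (2 ^ n)) :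
    s.val + (-sN - s).val = (-sN).val + 2 ^ n * ((s.val + (-sN - s).val) / 2 ^ n) := by
  haveI : NeZero (2 ^ n) := ⟨pow_ne_zero _ two_ne_zero⟩
  have hmod : (s.val + (-sN - s).val) % 2 ^ n = (-sN).val := by
    have h1 : ((s.val + (-sN - s).val : ℕ) : ZMod (2 ^ n)) = (((-sN).val : ℕ) : ZMod (2 ^ n)) := by
      push_cast
      rw [ZMod.natCast_zmod_val, ZMod.natCast_zmod_val, ZMod.natCast_zmod_val]
      ring
    rw [ZMod.natCast_eq_natCast_iff'] at h1
    rw [h1, Nat.mod_eq_of_lt (ZMod.val_lt _)]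
  have h := Nat.mod_add_div (s.val + (-sN - s).val) (2 ^ n)
  rw [hmod] at h
  exact h.symm

omit [NeZero N] in
/-- `(−1)^{(−s_N − s).val} = (−1)^{(−s_N).val} · (−1)^{s.val}` (`n ≥ 1`). [folklore] -/
theorem neg_one_pow_val_neg_sub {n : ℕ} (hn : 1 ≤ n) (sN s : ZMod (2 ^ n)) :
    (-1 : ℚ) ^ (-sN - s).val = (-1) ^ (-sN).val * (-1) ^ s.val := by
  have h := val_add_val_neg_sub_eq n sN s
  have hev : Even (2 ^ n) := Nat.even_pow.mpr ⟨even_two, by omega⟩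
  have e : (-1 : ℚ) ^ s.val * (-1) ^ (-sN - s).val = (-1) ^ (-sN).val := by
    rw [← pow_add, h, pow_add, pow_mul, hev.neg_one_pow, one_pow, mul_one]
  have e2 : ((-1 : ℚ) ^ s.val) ^ 2 = 1 := by rw [← pow_mul, mul_comm, pow_mul]; norm_num
  calc (-1 : ℚ) ^ (-sN - s).val = (-1) ^ (-sN - s).val * ((-1) ^ s.val) ^ 2 := by rw [e2, mul_one]
    _ = ((-1) ^ s.val * (-1) ^ (-sN - s).val) * (-1) ^ s.val := by ring
    _ = (-1) ^ (-sN).val * (-1) ^ s.val := by rw [e]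

omit [NeZero N] in
/-- `(−1)^{(−s_N).val} = (−1)^{s_N.val}` (`n ≥ 1`): the two residues add up to `0` or `2ⁿ`. [folklore] -/
theorem neg_one_pow_val_neg {n : ℕ} (hn : 1 ≤ n) (sN : ZMod (2 ^ n)) :
    (-1 : ℚ) ^ (-sN).val = (-1) ^ sN.val := by
  have h := neg_one_pow_val_neg_sub hn 0 sN
  rwa [neg_zero, zero_sub, ZMod.val_zero, pow_zero, one_mul] at h

/-- The weights of `θ_n` at `p = 2`: `w_n(η, s) = [η·5^s / 2^{n+2}]⁺_f` (as in `mazurTateElement`).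
An abbreviation local to this file's statements. [cite: Pollack2003, Def. 6.15] -/
def mtWeight (f : CuspForm (Gamma0 N) 2) (n : ℕ) (y : rootsOfUnity (torsionOrder 2) ℤ_[2])
    (s : ZMod (2 ^ n)) : ℚ :=
  ratPlusSymbol f
    (((PadicInt.toZModPow (n + cyclotomicExponent 2) ((y : ℤ_[2]ˣ) : ℤ_[2]) *
          (cyclotomicGenerator 2 : ZMod (2 ^ (n + cyclotomicExponent 2))) ^ s.val).val : ℚ) /
      (2 : ℚ) ^ (n + cyclotomicExponent 2))

/-- **The carry sum** `E_n := Σ_{η,s} m(s)·w_n(η,s)·(−1)^{s.val}`, `m(s) = (s.val + (−s_N−s).val)/2ⁿ`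
(the `2ⁿ`-term of the differentiated functional equation at `−2`). [folklore] -/
def carrySum (f : CuspForm (Gamma0 N) 2) (n : ℕ) (sN : ZMod (2 ^ n)) : ℚ :=
  ∑ᶠ y : rootsOfUnity (torsionOrder 2) ℤ_[2], ∑ s : ZMod (2 ^ n),
    (((s.val + (-sN - s).val) / 2 ^ n : ℕ) : ℚ) * (mtWeight f n y s * (-1) ^ s.val)

omit [NeZero N] in
/-- `θ_n` at `p = 2` as a finite sum of the weights times `(1+T)^{s.val}` (unfolding
`mazurTateElement`). [cite: Pollack2003, Def. 6.15] -/
theorem mazurTateElement_two_eq_sum_mtWeight (n : ℕ)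
    [Fintype (rootsOfUnity (torsionOrder 2) ℤ_[2])] :
    mazurTateElement f 2 n = ∑ y : rootsOfUnity (torsionOrder 2) ℤ_[2], ∑ s : ZMod (2 ^ n),
      C (mtWeight f n y s) * (X + 1) ^ s.val := by
  rw [mazurTateElement, finsum_eq_sum_of_fintype]
  simp only [mtWeight, Nat.cast_ofNat]

/-- The REFLECTED form of `θ_n` at `p = 2` (`mazurTateElement_eq_mul_reflect`) as a finite sum of
the weights times `(1+T)^{(−s_N − s).val}`. [cite: Ota2018, Prop. 5.16] -/
theorem mazurTateElement_two_eq_mul_sum_mtWeight {σ : ℤ} (hσ : σ ^ 2 = 1)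
    (hW : IsFrickeEigen N f (-(σ : ℂ))) (n : ℕ)
    {ηN : rootsOfUnity (torsionOrder 2) ℤ_[2]} {sN : ZMod (2 ^ n)}
    (hN : PadicInt.toZModPow (n + cyclotomicExponent 2) ((ηN : ℤ_[2]ˣ) : ℤ_[2]) *
        (cyclotomicGenerator 2 : ZMod (2 ^ (n + cyclotomicExponent 2))) ^ sN.val =
          (N : ZMod (2 ^ (n + cyclotomicExponent 2))))
    [Fintype (rootsOfUnity (torsionOrder 2) ℤ_[2])] :
    mazurTateElement f 2 n = C (σ : ℚ) * ∑ y : rootsOfUnity (torsionOrder 2) ℤ_[2],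
      ∑ s : ZMod (2 ^ n), C (mtWeight f n y s) * (X + 1) ^ (-sN - s).val := by
  rw [mazurTateElement_eq_mul_reflect hσ hW n hN, finsum_eq_sum_of_fintype]
  simp only [mtWeight, Nat.cast_ofNat]

/-- **The Mazur–Tate functional equation at `T = −2`, DIFFERENTIATED.** Let `f ∈ S₂(Γ₀(N))` have the
Fricke sign `σ = ±1` (`f|w_N = −σ f`), `n ≥ 1`, and let `N ≡ η_N · 5^{s_N} (mod 2^{n+2})` be the class
of the level. With `κ := (−s_N).val`, `w := σ·(−1)^κ` and the carry sum `E_n`: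
`(1 + w)·θ_n′(−2) + w·κ·θ_n(−2) = −w·2ⁿ·E_n`. (The undifferentiated companion is
`(1 − w)θ_n(−2) = 0`, `one_sub_mul_eval_neg_two_mazurTateElement`.)
[cite: MazurTateTeitelbaum1986Invent, §I.17] [cite: Ota2018, Prop. 5.16] -/
theorem mazurTateElement_derivative_eval_neg_two {σ : ℤ} (hσ : σ = 1 ∨ σ = -1)
    (hW : IsFrickeEigen N f (-(σ : ℂ))) {n : ℕ} (hn : 1 ≤ n)
    {ηN : rootsOfUnity (torsionOrder 2) ℤ_[2]} {sN : ZMod (2 ^ n)}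
    (hN : PadicInt.toZModPow (n + cyclotomicExponent 2) ((ηN : ℤ_[2]ˣ) : ℤ_[2]) *
        (cyclotomicGenerator 2 : ZMod (2 ^ (n + cyclotomicExponent 2))) ^ sN.val =
          (N : ZMod (2 ^ (n + cyclotomicExponent 2)))) :
    (1 + (σ : ℚ) * (-1) ^ (-sN).val) * (derivative (mazurTateElement f 2 n)).eval (-2) +
        (σ : ℚ) * (-1) ^ (-sN).val * ((-sN).val : ℚ) * (mazurTateElement f 2 n).eval (-2) =
      -((σ : ℚ) * (-1) ^ (-sN).val) * 2 ^ n * carrySum f n sN := by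
  haveI := neZero_torsionOrder 2
  letI : Fintype (rootsOfUnity (torsionOrder 2) ℤ_[2]) := Fintype.ofFinite _
  have hσ2 : σ ^ 2 = 1 := by rcases hσ with rfl | rfl <;> norm_num
  -- the two finite-sum forms of `θ_n`, over the product index type
  set ι := rootsOfUnity (torsionOrder 2) ℤ_[2] × ZMod (2 ^ n)
  set w : ι → ℚ := fun x ↦ mtWeight f n x.1 x.2 with hw
  set j₀ : ι → ℕ := fun x ↦ x.2.val with hj₀
  set j₁ : ι → ℕ := fun x ↦ (-sN - x.2).val with hj₁
  set m : ι → ℕ := fun x ↦ (x.2.val + (-sN - x.2).val) / 2 ^ n with hm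
  set κ : ℕ := (-sN).val with hκ
  have hθ : mazurTateElement f 2 n = ∑ x : ι, C (w x) * (X + 1 : ℚ[X]) ^ j₀ x := by
    rw [mazurTateElement_two_eq_sum_mtWeight, ← Fintype.sum_prod_type']
  have hrefl : mazurTateElement f 2 n = C (σ : ℚ) * ∑ x : ι, C (w x) * (X + 1 : ℚ[X]) ^ j₁ x := by
    rw [mazurTateElement_two_eq_mul_sum_mtWeight hσ2 hW n hN, ← Fintype.sum_prod_type']
  -- values and derivatives at `−2`
  have hA : (mazurTateElement f 2 n).eval (-2) = ∑ x : ι, w x * (-1) ^ j₀ x := by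
    rw [hθ, eval_neg_two_sum_C_mul_pow]
  have hB : (derivative (mazurTateElement f 2 n)).eval (-2) =
      -∑ x : ι, (j₀ x : ℚ) * (w x * (-1) ^ j₀ x) := by
    rw [hθ, eval_neg_two_derivative_sum_C_mul_pow]
  have hB' : (derivative (mazurTateElement f 2 n)).eval (-2) =
      -(σ : ℚ) * ∑ x : ι, (j₁ x : ℚ) * (w x * (-1) ^ j₁ x) := by
    rw [hrefl, derivative_C_mul, eval_mul, eval_C, eval_neg_two_derivative_sum_C_mul_pow]
    ring
  -- the carry identity, termwise
  have hjm : ∀ x : ι, (j₁ x : ℚ) = κ + 2 ^ n * m x - j₀ x := by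
    intro x
    have h := val_add_val_neg_sub_eq n sN x.2
    have h' := congrArg (fun t : ℕ ↦ (t : ℚ)) h
    push_cast at h'
    simp only [hj₁, hj₀, hm, hκ]
    linarith
  have hsgn : ∀ x : ι, (-1 : ℚ) ^ j₁ x = (-1) ^ κ * (-1) ^ j₀ x := fun x ↦
    neg_one_pow_val_neg_sub hn sN x.2
  -- rewrite the reflected derivative sum
  have hsum : ∑ x : ι, (j₁ x : ℚ) * (w x * (-1) ^ j₁ x) =
      (-1) ^ κ * ((κ : ℚ) * ∑ x : ι, w x * (-1) ^ j₀ x +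
        2 ^ n * ∑ x : ι, (m x : ℚ) * (w x * (-1) ^ j₀ x) -
        ∑ x : ι, (j₀ x : ℚ) * (w x * (-1) ^ j₀ x)) := by
    rw [Finset.mul_sum, Finset.mul_sum, ← Finset.sum_add_distrib, ← Finset.sum_sub_distrib,
      Finset.mul_sum]
    refine Finset.sum_congr rfl fun x _ ↦ ?_
    rw [hjm x, hsgn x]
    ring
  have hE : carrySum f n sN = ∑ x : ι, (m x : ℚ) * (w x * (-1) ^ j₀ x) := by
    rw [carrySum, finsum_eq_sum_of_fintype, ← Fintype.sum_prod_type']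
  have key : -∑ x : ι, (j₀ x : ℚ) * (w x * (-1) ^ j₀ x) =
      -(σ : ℚ) * ((-1) ^ κ * ((κ : ℚ) * ∑ x : ι, w x * (-1) ^ j₀ x +
        2 ^ n * ∑ x : ι, (m x : ℚ) * (w x * (-1) ^ j₀ x) -
        ∑ x : ι, (j₀ x : ℚ) * (w x * (-1) ^ j₀ x))) := by
    rw [← hsum, ← hB', ← hB]
  rw [hB, hA, hE]
  linear_combination key

/-- **At `w = +1`: `2·θ_n′(−2) + κ·θ_n(−2) = −2ⁿ·E_n`** (`σ·(−1)^{s_N} = +1`, i.e. `σ·χ₈(N) = +1`,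
`neg_one_pow_val_eq_chi8`). [cite: MazurTateTeitelbaum1986Invent, §I.17] [cite: Ota2018, Prop. 5.16] -/
theorem two_mul_derivative_mazurTateElement_eval_neg_two {σ : ℤ} (hσ : σ = 1 ∨ σ = -1)
    (hW : IsFrickeEigen N f (-(σ : ℂ))) (hN2 : ¬ 2 ∣ N) {n : ℕ} (hn : 1 ≤ n)
    {ηN : rootsOfUnity (torsionOrder 2) ℤ_[2]} {sN : ZMod (2 ^ n)}
    (hN : PadicInt.toZModPow (n + cyclotomicExponent 2) ((ηN : ℤ_[2]ˣ) : ℤ_[2]) *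
        (cyclotomicGenerator 2 : ZMod (2 ^ (n + cyclotomicExponent 2))) ^ sN.val =
          (N : ZMod (2 ^ (n + cyclotomicExponent 2))))
    (hsign : σ * ZMod.χ₈ (N : ZMod 8) = 1) :
    2 * (derivative (mazurTateElement f 2 n)).eval (-2) +
        ((-sN).val : ℚ) * (mazurTateElement f 2 n).eval (-2) = -2 ^ n * carrySum f n sN := by
  have _ := hN2
  have h := mazurTateElement_derivative_eval_neg_two hσ hW hn hN
  have hχ := neg_one_pow_val_eq_chi8 hn hN
  have hw : (σ : ℚ) * (-1) ^ (-sN).val = 1 := by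
    rw [neg_one_pow_val_neg hn sN]
    have : ((σ * ZMod.χ₈ (N : ZMod 8) : ℤ) : ℚ) = 1 := by rw [hsign]; norm_num
    rw [← hχ] at this
    push_cast at this
    exact this
  rw [hw] at h
  linear_combination h

/-! ## §3. The carry sum is `2`-adically bounded by the symbols -/

omit [NeZero N] in
/-- If every weight `w_n(η,s)` has `‖·‖₂ ≤ 2` then `‖E_n‖₂ ≤ 2` (ultrametric inequality; the carries
are natural numbers). [folklore] -/
theorem norm_carrySum_le {n : ℕ} (sN : ZMod (2 ^ n))
    (hw : ∀ (y : rootsOfUnity (torsionOrder 2) ℤ_[2]) (s : ZMod (2 ^ n)),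
      ‖((mtWeight f n y s : ℚ) : ℚ_[2])‖ ≤ 2) :
    ‖((carrySum f n sN : ℚ) : ℚ_[2])‖ ≤ 2 := by
  haveI := neZero_torsionOrder 2
  letI : Fintype (rootsOfUnity (torsionOrder 2) ℤ_[2]) := Fintype.ofFinite _
  rw [carrySum, finsum_eq_sum_of_fintype]
  push_cast
  refine IsUltrametricDist.norm_sum_le_of_forall_le_of_nonneg (by norm_num) fun y _ ↦ ?_
  refine IsUltrametricDist.norm_sum_le_of_forall_le_of_nonneg (by norm_num) fun s _ ↦ ?_
  have hm : ‖(((s.val + (-sN - s).val) / 2 ^ n : ℕ) : ℚ_[2])‖ ≤ 1 := by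
    rw [show (((s.val + (-sN - s).val) / 2 ^ n : ℕ) : ℚ_[2]) =
      ((((s.val + (-sN - s).val) / 2 ^ n : ℕ) : ℤ) : ℚ_[2]) by norm_cast]
    exact Padic.norm_int_le_one _
  have hs : ‖(-1 : ℚ_[2]) ^ s.val‖ ≤ 1 := by
    rw [norm_pow, norm_neg, norm_one, one_pow]
  calc ‖(((s.val + (-sN - s).val) / 2 ^ n : ℕ) : ℚ_[2]) *
          (((mtWeight f n y s : ℚ) : ℚ_[2]) * (-1 : ℚ_[2]) ^ s.val)‖
        = ‖(((s.val + (-sN - s).val) / 2 ^ n : ℕ) : ℚ_[2])‖ *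
          (‖((mtWeight f n y s : ℚ) : ℚ_[2])‖ * ‖(-1 : ℚ_[2]) ^ s.val‖) := by
          rw [norm_mul, norm_mul]
    _ ≤ 1 * (2 * 1) := by
          gcongr
          exact hw y s
    _ = 2 := by norm_num

/-- **For `2 ∤ N` and `a₂(f)` even the weights are bounded: `‖w_n(η,s)‖₂ ≤ 2`** (the tree's
`norm_ratPlusSymbol_div_two_pow_le_two_of_even`: the Eisenstein number `a₂ − 3` is odd).
[cite: Sprung2017, §1.1] -/
theorem norm_mtWeight_le (hf0 : IsNewform0 f) (hQ : coeffField f = ⊥) (hN2 : ¬ 2 ∣ N) {ap : ℤ}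
    (hap : cuspCoeff f 2 = ap) (hpa : (2 : ℤ) ∣ ap) (n : ℕ)
    (y : rootsOfUnity (torsionOrder 2) ℤ_[2]) (s : ZMod (2 ^ n)) :
    ‖((mtWeight f n y s : ℚ) : ℚ_[2])‖ ≤ 2 :=
  Sprung2017.norm_ratPlusSymbol_div_two_pow_le_two_of_even hf0 hQ hN2 hap hpa _ _

/-- **(FE) packaged for the blind `♭`-law.** `2 ∤ N`, `a₂(f)` even, Fricke sign `σ` with
`σ·χ₈(N) = +1`, `n ≥ 1`, level class `N ≡ η_N 5^{s_N}`: there is `g ∈ ℤ₂` with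
`2·(2θ_n′(−2) + κ θ_n(−2)) = −2ⁿ·g` in `ℚ₂` (`κ = (−s_N).val`, `g = 2E_n`).
[cite: MazurTateTeitelbaum1986Invent, §I.17] -/
theorem exists_padicInt_fe_neg_two (hf0 : IsNewform0 f) (hQ : coeffField f = ⊥) (hN2 : ¬ 2 ∣ N)
    {ap : ℤ} (hap : cuspCoeff f 2 = ap) (hpa : (2 : ℤ) ∣ ap)
    {σ : ℤ} (hσ : σ = 1 ∨ σ = -1) (hW : IsFrickeEigen N f (-(σ : ℂ)))
    (hsign : σ * ZMod.χ₈ (N : ZMod 8) = 1) {n : ℕ} (hn : 1 ≤ n)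
    {ηN : rootsOfUnity (torsionOrder 2) ℤ_[2]} {sN : ZMod (2 ^ n)}
    (hN : PadicInt.toZModPow (n + cyclotomicExponent 2) ((ηN : ℤ_[2]ˣ) : ℤ_[2]) *
        (cyclotomicGenerator 2 : ZMod (2 ^ (n + cyclotomicExponent 2))) ^ sN.val =
          (N : ZMod (2 ^ (n + cyclotomicExponent 2)))) :
    ∃ g : ℤ_[2], (2 : ℚ_[2]) * ((((2 * (derivative (mazurTateElement f 2 n)).eval (-2) +
        ((-sN).val : ℚ) * (mazurTateElement f 2 n).eval (-2) : ℚ)) : ℚ_[2])) =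
      -(2 : ℚ_[2]) ^ n * (g : ℚ_[2]) := by
  have h := two_mul_derivative_mazurTateElement_eval_neg_two hσ hW hN2 hn hN hsign
  have hE : ‖((carrySum f n sN : ℚ) : ℚ_[2])‖ ≤ 2 :=
    norm_carrySum_le sN (norm_mtWeight_le hf0 hQ hN2 hap hpa n)
  have hg : ‖(2 : ℚ_[2]) * ((carrySum f n sN : ℚ) : ℚ_[2])‖ ≤ 1 := by
    rw [norm_mul, show (2 : ℚ_[2]) = ((2 : ℕ) : ℚ_[2]) by norm_cast, Padic.norm_p]
    calc ((2 : ℕ) : ℝ)⁻¹ * ‖((carrySum f n sN : ℚ) : ℚ_[2])‖ ≤ ((2 : ℕ) : ℝ)⁻¹ * 2 := by gcongr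
      _ = 1 := by norm_num
  refine ⟨⟨(2 : ℚ_[2]) * ((carrySum f n sN : ℚ) : ℚ_[2]), hg⟩, ?_⟩
  rw [h]
  push_cast
  ring

end BlindFlat

end Summit.BirchSwinnertonDyer.Rank1Residual.Supersingular

end
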